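import Mathlib
import HarnessLib
import HarnessLib.Audit
import Summits.CriticalPhenomena.PercolationContinuityZ3.Theorems.PercNearOneGluingNoHeavyLowerTailHexMSMatchSym

/-!
# (MATCH), Δ-HEX and HEX-MS when the dead members lie on one antipodal axis (hp-7 gen 69)

Support file for crux `stmt-CriticalPhenomena-4575` (route `PercNearOneGluingNoHeavy`), hull-port seat `prim-hp-7` (generation 69);
`--supports stmt-CriticalPhenomena-4575`.  No `sorry`.  Memo: `run/shared/lean/prim/prim-hp-7/FROM-prim-hp-7-g69-MATCH-SYMMETRIC.md`.

Vocabulary of `…HexMSMatch` / `…HexMSMatchSym`: antipodal instance `(U, 𝒟, x)`, `dead U 𝒟 x` (members that are not far meets/joins),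
`candidates 𝒟 x s` (absent far products of `s`), `MatchHall` = Conjecture (MATCH) (Hall's condition for dead ↔ candidates).

* `card_le_card_biUnion_candidates_of_complClosed_family` — the complement-symmetry reduction of `…HexMSMatchSym` RELATIVE to any
  complement-closed family `E` of dead members: Hall's condition for the complement-closed subfamilies of `E` gives it for all subfamilies of `E`.
* `card_le_card_biUnion_candidates_of_axis` — **Hall's condition holds for every family of dead members whose labels lie on ONE antipodal
  axis `{ℓ, ℓ+3}`, in an ARBITRARY (three-axis) instance**: for a complement-closed such `A` with half `B = {x = ℓ}` the candidates contain
  `B \\ B` and its complements (gen 67's same-label lemma `sdiff_notMem_of_dead_of_label_eq`: a member equal to `b \ b'` would make `b` a far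
  join or `b'` a close difference), which number `≥ 2 #B = #A` by Δ-MS (`two_mul_card_le_card_cl_diffs`, gen 66).
* `matchHall_of_dead_oneAxis`, `deltaHexRel_of_dead_oneAxis`, `hexMSRel_of_dead_oneAxis` — hence **(MATCH), Δ-HEX (`#𝒟 ≤ #symGen`) and
  HEX-MS (`#𝒟 ≤ 2 #gen`) hold for every antipodal instance all of whose dead members carry labels on a single antipodal axis** — a new
  unconditional case of Conjecture HEX-MS with all three axes present (gen 64 had: labels on ≤ 2 adjacent axes; `∅ ∈ 𝒟`).
  The dead sets supported on two / three axes remain open (gen 69 memo: verified exhaustively on `2^[4]`, deep sampling on `2^[5]`, `2^[6]`).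
-/

namespace Summit.CriticalPhenomena.PercolationContinuityZ3.Theorems

namespace GeneratedDonors

open Finset FinsetFamily

variable {α : Type*} [DecidableEq α]
variable {U : Finset α} {𝒟 : Finset (Finset α)} {x : Finset α → ZMod 6}

section Relative

/-- **Complement symmetry, relative form.**  Let `E` be a complement-closed family of dead members.  If Hall's condition
`#A ≤ #N(A)` holds for every complement-closed `A ⊆ E`, it holds for every `A ⊆ E`. -/
theorem card_le_card_biUnion_candidates_of_complClosed_family (hU : ∀ a ∈ 𝒟, a ⊆ U) (hco : ∀ a ∈ 𝒟, U \ a ∈ 𝒟)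
    (hanti : ∀ a ∈ 𝒟, x (U \ a) = x a + 3) {E : Finset (Finset α)} (hE : E ⊆ dead U 𝒟 x)
    (hEcl : ∀ a ∈ E, U \ a ∈ E)
    (h : ∀ A ⊆ E, (∀ a ∈ A, U \ a ∈ A) → #A ≤ #(A.biUnion (candidates 𝒟 x)))
    {A : Finset (Finset α)} (hA : A ⊆ E) : #A ≤ #(A.biUnion (candidates 𝒟 x)) := by
  classical
  have hAD : ∀ a ∈ A, a ∈ 𝒟 := fun a ha => (mem_filter.mp (show a ∈ dead U 𝒟 x from hE (hA ha))).1
  have hAU : ∀ a ∈ A, a ⊆ U := fun a ha => hU a (hAD a ha)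
  set Ac : Finset (Finset α) := A.image fun a => U \ a with hAc_def
  have hAc : Ac ⊆ E := by
    intro b hb
    obtain ⟨a, ha, rfl⟩ := mem_image.mp hb
    exact hEcl a (hA ha)
  have hcc : ∀ a : Finset α, a ⊆ U → U \ (U \ a) = a := fun a ha => Finset.sdiff_sdiff_eq_self ha
  have hclosed₁ : ∀ a ∈ A ∪ Ac, U \ a ∈ A ∪ Ac := by
    intro a ha
    rw [mem_union] at ha ⊢
    rcases ha with ha | ha
    · exact Or.inr (mem_image_of_mem _ ha)
    · obtain ⟨b, hb, rfl⟩ := mem_image.mp ha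
      rw [hcc b (hAU b hb)]; exact Or.inl hb
  have hclosed₂ : ∀ a ∈ A ∩ Ac, U \ a ∈ A ∩ Ac := by
    intro a ha
    rw [mem_inter] at ha ⊢
    obtain ⟨ha₁, ha₂⟩ := ha
    obtain ⟨b, hb, rfl⟩ := mem_image.mp ha₂
    rw [hcc b (hAU b hb)]
    exact ⟨hb, mem_image.mpr ⟨U \ b, ha₁, hcc b (hAU b hb)⟩⟩
  have h₁ := h (A ∪ Ac) (union_subset hA hAc) hclosed₁
  have h₂ := h (A ∩ Ac) (inter_subset_left.trans hA) hclosed₂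
  set P := A.biUnion (candidates 𝒟 x) with hP_def
  set Q := Ac.biUnion (candidates 𝒟 x) with hQ_def
  have hQP : Q = P.image fun p => U \ p := by
    rw [hQ_def, hAc_def, image_biUnion, hP_def, biUnion_image]
    apply biUnion_congr rfl
    intro a ha
    exact candidates_compl hU hco hanti (hAD a ha)
  have hPU : ∀ p ∈ P, p ⊆ U := by
    intro p hp
    obtain ⟨a, ha, hpa⟩ := mem_biUnion.mp hp
    exact candidates_subset_ground hU (hAD a ha) hpa
  have hinjP : Set.InjOn (fun p : Finset α => U \ p) ↑P := by
    intro p hp q hq hpq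
    have h1 := congrArg (fun t => U \ t) hpq
    simp only [hcc p (hPU p (mem_coe.mp hp)), hcc q (hPU q (mem_coe.mp hq))] at h1
    exact h1
  have hcardQ : #Q = #P := by rw [hQP, card_image_of_injOn hinjP]
  have hinjA : Set.InjOn (fun a : Finset α => U \ a) ↑A := by
    intro p hp q hq hpq
    have h1 := congrArg (fun t => U \ t) hpq
    simp only [hcc p (hAU p (mem_coe.mp hp)), hcc q (hAU q (mem_coe.mp hq))] at h1
    exact h1
  have hcardAc : #Ac = #A := by rw [hAc_def, card_image_of_injOn hinjA]
  have hunion : (A ∪ Ac).biUnion (candidates 𝒟 x) = P ∪ Q := union_biUnion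
  have hinter : (A ∩ Ac).biUnion (candidates 𝒟 x) ⊆ P ∩ Q := by
    intro p hp
    obtain ⟨a, ha, hpa⟩ := mem_biUnion.mp hp
    rw [mem_inter] at ha ⊢
    exact ⟨mem_biUnion.mpr ⟨a, ha.1, hpa⟩, mem_biUnion.mpr ⟨a, ha.2, hpa⟩⟩
  rw [hunion] at h₁
  have h₂' : #(A ∩ Ac) ≤ #(P ∩ Q) := h₂.trans (card_le_card hinter)
  have hPQ : #(P ∪ Q) + #(P ∩ Q) = #P + #Q := card_union_add_card_inter P Q
  have hAA : #(A ∪ Ac) + #(A ∩ Ac) = #A + #Ac := card_union_add_card_inter A Ac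
  show #A ≤ #P
  omega

end Relative

section OneAxis

/-- The two labels of an antipodal axis: `s ∈ {ℓ, ℓ+3}` iff `s + 3 ∈ {ℓ, ℓ+3}`. -/
theorem add_three_mem_axis_iff (ℓ s : ZMod 6) : (s + 3 = ℓ ∨ s + 3 = ℓ + 3) ↔ (s = ℓ ∨ s = ℓ + 3) := by
  revert ℓ s; decide

/-- `ℓ + 3 ≠ ℓ` in `ZMod 6`, in the form: `s = ℓ → s + 3 ≠ ℓ`. -/
theorem add_three_ne_of_eq {ℓ s : ZMod 6} (h : s = ℓ) : s + 3 ≠ ℓ := by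
  revert ℓ s; decide

/-- If `s` is on the axis of `ℓ` but `s ≠ ℓ` then `s + 3 = ℓ`. -/
theorem add_three_eq_of_axis {ℓ s : ZMod 6} (h : s = ℓ ∨ s = ℓ + 3) (hne : s ≠ ℓ) : s + 3 = ℓ := by
  revert ℓ s; decide

/-- **Same-label dead members: the difference and the complemented reverse difference are candidates.**  For dead `b, b'` with
`x b = x b'`: `b \ b' ∈ candidates b` and `U \ (b' \ b) ∈ candidates b` (gen 67's same-label lemma, repackaged). -/
theorem sdiff_mem_candidates_of_label_eq (hU : ∀ a ∈ 𝒟, a ⊆ U) (hco : ∀ a ∈ 𝒟, U \ a ∈ 𝒟)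
    (hanti : ∀ a ∈ 𝒟, x (U \ a) = x a + 3) {b b' : Finset α} (hb : b ∈ dead U 𝒟 x) (hb' : b' ∈ dead U 𝒟 x)
    (hlab : x b = x b') : b \ b' ∈ candidates 𝒟 x b ∧ U \ (b' \ b) ∈ candidates 𝒟 x b := by
  have hbD : b ∈ 𝒟 := (mem_filter.mp hb).1
  have hb'D : b' ∈ 𝒟 := (mem_filter.mp hb').1
  have hbdead : b ∉ symGen U 𝒟 x := (mem_filter.mp hb).2
  have hb'dead : b' ∉ symGen U 𝒟 x := (mem_filter.mp hb').2
  have hfar : ¬ Close (x b) (x (U \ b')) := by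
    rw [hanti b' hb'D, ← hlab]
    have key : ∀ s : ZMod 6, ¬ Close s (s + 3) := by decide
    exact key _
  have hsd : ∀ {c c' : Finset α}, c ∈ 𝒟 → c' ∈ 𝒟 → c \ c' = c ∩ (U \ c') := by
    intro c c' hc hc'
    have h1 := sdiff_univ_compl_eq_inter (U := U) (f := U \ c') (hU c hc)
    rw [Finset.sdiff_sdiff_eq_self (hU c' hc')] at h1
    exact h1
  have h1 := (sdiff_notMem_of_dead_of_label_eq hU hco hanti hbD hb'D hbdead hb'dead hlab).2
  have h2 := (sdiff_notMem_of_dead_of_label_eq hU hco hanti hb'D hbD hb'dead hbdead hlab.symm).2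
  unfold candidates
  constructor
  · rw [mem_sdiff]
    exact ⟨mem_farProducts.mpr ⟨U \ b', hco b' hb'D, hfar, Or.inl (hsd hbD hb'D)⟩, h1⟩
  · rw [mem_sdiff]
    refine ⟨mem_farProducts.mpr ⟨U \ b', hco b' hb'D, hfar, Or.inr ?_⟩, fun hmem => h2 ?_⟩
    · rw [union_comm, compl_union_eq_compl_sdiff_inter b' (hU b hbD), ← hsd hb'D hbD]
    · have h3 := hco _ hmem
      rwa [Finset.sdiff_sdiff_eq_self (sdiff_subset.trans (hU b' hb'D))] at h3

/-- **Hall's condition for dead families on one antipodal axis (any instance).**  If `A` is a family of dead members all of whose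
labels lie in `{ℓ, ℓ+3}`, then `#A ≤ #(⋃_{a ∈ A} candidates a)`. -/
theorem card_le_card_biUnion_candidates_of_axis (hU : ∀ a ∈ 𝒟, a ⊆ U) (hco : ∀ a ∈ 𝒟, U \ a ∈ 𝒟)
    (hanti : ∀ a ∈ 𝒟, x (U \ a) = x a + 3) (ℓ : ZMod 6) {A : Finset (Finset α)} (hA : A ⊆ dead U 𝒟 x)
    (hlab : ∀ a ∈ A, x a = ℓ ∨ x a = ℓ + 3) : #A ≤ #(A.biUnion (candidates 𝒟 x)) := by
  classical
  -- the complement-closed family E of all dead members on the axis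
  set E : Finset (Finset α) := (dead U 𝒟 x).filter fun a => x a = ℓ ∨ x a = ℓ + 3 with hE_def
  have hE : E ⊆ dead U 𝒟 x := filter_subset _ _
  have hdeadD : ∀ a ∈ dead U 𝒟 x, a ∈ 𝒟 := fun a ha => (mem_filter.mp ha).1
  have hEcl : ∀ a ∈ E, U \ a ∈ E := by
    intro a ha
    rw [hE_def, mem_filter] at ha ⊢
    refine ⟨compl_mem_dead hU hco ha.1, ?_⟩
    rw [hanti a (hdeadD a ha.1)]
    exact (add_three_mem_axis_iff ℓ (x a)).mpr ha.2
  have hAE : A ⊆ E := by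
    intro a ha
    rw [hE_def, mem_filter]
    exact ⟨hA ha, hlab a ha⟩
  refine card_le_card_biUnion_candidates_of_complClosed_family hU hco hanti hE hEcl ?_ hAE
  -- Hall for complement-closed A' ⊆ E via Δ-MS on the half B = {x = ℓ}
  intro A' hA'E hA'cl
  have hA'dead : ∀ a ∈ A', a ∈ dead U 𝒟 x := fun a ha => hE (hA'E ha)
  have hA'D : ∀ a ∈ A', a ∈ 𝒟 := fun a ha => hdeadD a (hA'dead a ha)
  have hA'lab : ∀ a ∈ A', x a = ℓ ∨ x a = ℓ + 3 := fun a ha => (mem_filter.mp (hA'E ha)).2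
  set B : Finset (Finset α) := A'.filter fun a => x a = ℓ with hB_def
  have hBA : B ⊆ A' := filter_subset _ _
  have hBU : ∀ f ∈ B, f ⊆ U := fun f hf => hU f (hA'D f (hBA hf))
  have hfree : ∀ f ∈ B, U \ f ∉ B := by
    intro f hf hcf
    rw [hB_def, mem_filter] at hf hcf
    have h1 := hcf.2
    rw [hanti f (hA'D f hf.1)] at h1
    exact add_three_ne_of_eq hf.2 h1
  have hcc : ∀ a : Finset α, a ⊆ U → U \ (U \ a) = a := fun a ha => Finset.sdiff_sdiff_eq_self ha
  have himg : A' \ B = B.image fun f => U \ f := by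
    ext a
    rw [mem_sdiff, mem_image]
    constructor
    · rintro ⟨haA, haB⟩
      have hna : x a ≠ ℓ := fun h => haB (by rw [hB_def, mem_filter]; exact ⟨haA, h⟩)
      refine ⟨U \ a, ?_, hcc a (hU a (hA'D a haA))⟩
      rw [hB_def, mem_filter]
      refine ⟨hA'cl a haA, ?_⟩
      rw [hanti a (hA'D a haA)]
      exact add_three_eq_of_axis (hA'lab a haA) hna
    · rintro ⟨f, hf, rfl⟩
      exact ⟨hA'cl f (hBA hf), fun h => hfree f hf h⟩
  have hinjB : Set.InjOn (fun f : Finset α => U \ f) ↑B := by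
    intro p hp q hq hpq
    have h1 := congrArg (fun t => U \ t) hpq
    simp only [hcc p (hBU p (mem_coe.mp hp)), hcc q (hBU q (mem_coe.mp hq))] at h1
    exact h1
  have hcardA : #A' = 2 * #B := by
    have h1 : #(A' \ B) + #B = #A' := card_sdiff_add_card_eq_card hBA
    rw [himg, card_image_of_injOn hinjB] at h1
    omega
  have hsub : (B \\ B) ∪ (B \\ B).image (fun z => U \ z) ⊆ A'.biUnion (candidates 𝒟 x) := by
    intro p hp
    rw [mem_union, mem_image] at hp
    rcases hp with hp | ⟨q, hq, rfl⟩
    · rw [Finset.mem_diffs] at hp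
      obtain ⟨b, hb, b', hb', rfl⟩ := hp
      rw [hB_def, mem_filter] at hb hb'
      exact mem_biUnion.mpr ⟨b, hb.1, (sdiff_mem_candidates_of_label_eq hU hco hanti (hA'dead b hb.1)
        (hA'dead b' hb'.1) (by rw [hb.2, hb'.2])).1⟩
    · rw [Finset.mem_diffs] at hq
      obtain ⟨b', hb', b, hb, rfl⟩ := hq
      rw [hB_def, mem_filter] at hb hb'
      exact mem_biUnion.mpr ⟨b, hb.1, (sdiff_mem_candidates_of_label_eq hU hco hanti (hA'dead b hb.1)
        (hA'dead b' hb'.1) (by rw [hb.2, hb'.2])).2⟩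
  have hMS := two_mul_card_le_card_cl_diffs U B hBU hfree
  rw [hcardA]
  exact hMS.trans (card_le_card hsub)

/-- **(MATCH) when the dead set lies on one antipodal axis.**  If every dead member of the antipodal instance has its label in
`{ℓ, ℓ+3}` (alive members may carry any labels), Conjecture (MATCH) holds. -/
theorem matchHall_of_dead_oneAxis (hU : ∀ a ∈ 𝒟, a ⊆ U) (hco : ∀ a ∈ 𝒟, U \ a ∈ 𝒟)
    (hanti : ∀ a ∈ 𝒟, x (U \ a) = x a + 3) (ℓ : ZMod 6)
    (hdead : ∀ s ∈ dead U 𝒟 x, x s = ℓ ∨ x s = ℓ + 3) : MatchHall U 𝒟 x :=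
  fun _ hA => card_le_card_biUnion_candidates_of_axis hU hco hanti ℓ hA fun a ha => hdead a (hA ha)

/-- **Δ-HEX when the dead set lies on one antipodal axis**: `#𝒟 ≤ #(symGen U 𝒟 x)`. -/
theorem deltaHexRel_of_dead_oneAxis (ℓ : ZMod 6)
    (hdead : (∀ a ∈ 𝒟, a ⊆ U) → (∀ a ∈ 𝒟, U \ a ∈ 𝒟) → (∀ a ∈ 𝒟, x (U \ a) = x a + 3) →
      ∀ s ∈ dead U 𝒟 x, x s = ℓ ∨ x s = ℓ + 3) : DeltaHexRel U 𝒟 x := by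
  intro hU hco hanti
  exact deltaHexRel_of_matchHall (matchHall_of_dead_oneAxis hU hco hanti ℓ (hdead hU hco hanti)) hU hco hanti

/-- **HEX-MS when the dead set lies on one antipodal axis**: if every member of `𝒟` that is not a far meet/join carries a label in
`{ℓ, ℓ+3}`, then `#𝒟 ≤ 2 · #(gen 𝒟 x)` — an unconditional case of Conjecture HEX-MS with all three axes allowed for the alive members. -/
theorem hexMSRel_of_dead_oneAxis (ℓ : ZMod 6)
    (hdead : (∀ a ∈ 𝒟, a ⊆ U) → (∀ a ∈ 𝒟, U \ a ∈ 𝒟) → (∀ a ∈ 𝒟, x (U \ a) = x a + 3) →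
      ∀ s ∈ dead U 𝒟 x, x s = ℓ ∨ x s = ℓ + 3) : HexMSRel U 𝒟 x := by
  intro hU hco hanti
  have h1 := deltaHexRel_of_dead_oneAxis ℓ hdead hU hco hanti
  have h2 := card_symGen_le U 𝒟 x
  omega

/-- In particular: **if every member of two of the three axis-classes is a far meet or far join, HEX-MS holds** (dead members can then
only sit on the remaining axis).  Stated with the dead set: `dead ⊆ {x = ℓ} ∪ {x = ℓ + 3}`. -/
theorem hexMSAt_of_dead_oneAxis {β : Type*} [Fintype β] [DecidableEq β] (𝒟 : Finset (Finset β)) (x : Finset β → ZMod 6)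
    (ℓ : ZMod 6) (hdead : ∀ s ∈ dead univ 𝒟 x, x s = ℓ ∨ x s = ℓ + 3) : HexMSAt 𝒟 x :=
  (hexMSRel_univ_iff 𝒟 x).mp (hexMSRel_of_dead_oneAxis ℓ fun _ _ _ => hdead)

end OneAxis

end GeneratedDonors

end Summit.CriticalPhenomena.PercolationContinuityZ3.Theorems
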